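import Summits.ResolutionOfSingularities.ResolutionOfSingularities.Theorems.MarkedTransferCampaignW34AxisEscapeAnyDim
import Mathlib.Data.Fin.VecNotation
import Literature.AlgebraicGeometry.Hironaka2017.AxisEscape
import HarnessLib

/-!
# KILL TEST K3.4 (cell res-hironaka, rung L, slot W3.4, L-G3 datum Ě) — file F2b: faithfulness of the tower encoding,
# the DICTIONARY to the prior three-variable module, and the maximal-contact plane instance

[OURS · L1 W3.4 / kill test K3.4] — folklore polynomial algebra continuing file F2a
(`MarkedTransferCampaignW34AxisEscapeAnyDim`); replaces the role of NO printed item and is NOT a statement of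
H. Hironaka's manuscript (2017-03-23) [claim: Hironaka2017, status: under-review]. AI review is weaker than expert review.

* FAITHFULNESS `X_pow_dvd_zIter_of_towerPermissible`: under `TowerPermissible z g b m` one has `X_z^{kb} ∣ zIter z k g`
  for `k ≤ m + 1`, so the defining condition `zIter z k g ∈ 𝔪^{(k+1)b}` says exactly that the CONTROLLED transform
  `X_z^{−kb}·zIter z k g` (Def. 2.1 with the literal exponent `b`) has order `≥ b` at the chart origin `R_k`;
* DICTIONARY: `zChart_fin_three` (`zChart 2 = CuspContact.σt`), `zIter_fin_three`, `idealOfVars_fin_three`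
  (`𝔪 = CuspContact.M`), `towerPermissible_fin_three_iff` (`TowerPermissible 2 g b m ↔ AxisEscape.TowerPermissible g b m`),
  `axisWt_fin_three` (`= i + j`), `prior_escape_as_instance` — the prior witness
  `Literature.AlgebraicGeometry.Hironaka2017.AxisEscape.not_towerPermissible_of_mem_support` IS the `σ = Fin 3`, `z = 2`
  instance of F2a;
* THE MAXIMAL-CONTACT PLANE `{y = 0} ≅ 𝔸²_{x,z}` (the natural ambient reduction `⇁_Y` of the witness, Th. 3.10):
  `witnessOnPlane_mem` — the restriction `x²z² − x⁵ = x²(z² − x³)` of `y² − x²z² + x⁵` lies in `(x)²`, so on the plane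
  too the z-axis is in `Sing` of the reduction of `Ê` and its tower never escapes the reduction of `Ê` itself — while
  `plane_escape`: every literal pair on the plane with a monomial `x^i z^l`, `i < b` (any focus whose singular locus
  omits the axis, e.g. `Sing = {O}`) loses the induced tower by step `l`. Same dichotomy as upstairs: the AR-reduction
  does not rescue persistence.

## References
* H. Hironaka, ms. 2017-03-23 — Def. 2.1 p.5, Th. 3.10 p.10, Def. 3.12 p.11, Eqs. (43)/(44) p.30 (scope only;
  ADJUDICATED, never a premise). [Hironaka2017]
* cell res-hironaka: plan/RESCUE-SEED.md §1 L-G3 W3.4; L/res-L1-k34/PREREG-K3.4.md.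
-/

noncomputable section

namespace Summit.ResolutionOfSingularities.ResolutionOfSingularities.Theorems.CampaignW34

set_option linter.dupNamespace false -- mandated namespace of this single-conjunct summit

open MvPolynomial

variable {R : Type*} [CommRing R] {σ : Type*}

/-! ## Faithfulness of the encoding -/

/-- [OURS · K3.4] An element of `𝔪^b` becomes divisible by `X_z^b` in the z-chart (every monomial `X^e` with
`degree e ≥ b` goes to `X^{shift z e}` with `(shift z e) z = degree e ≥ b`). [folklore] -/
theorem X_pow_dvd_zChart_of_mem_pow (z : σ) {b : ℕ} {h : MvPolynomial σ R} (hh : h ∈ idealOfVars σ R ^ b) :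
    (X z : MvPolynomial σ R) ^ b ∣ zChart z h := by
  classical
  have hdeg := (mem_pow_idealOfVars_iff _ _).mp hh
  rw [zChart_eq_sum]
  refine Finset.dvd_sum fun e he => ?_
  refine ⟨monomial (shift z e - Finsupp.single z b) (coeff e h), ?_⟩
  have hb : b ≤ (shift z e) z := by
    rw [shift_apply_self, ← degree_eq_add_axisWt]
    exact hdeg e he
  have hsplit : shift z e = Finsupp.single z b + (shift z e - Finsupp.single z b) := by
    ext i
    by_cases hi : i = z
    · subst hi
      simp only [Finsupp.coe_add, Pi.add_apply, Finsupp.single_eq_same, Finsupp.coe_tsub, Pi.sub_apply]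
      omega
    · simp [Ne.symm hi]
  conv_lhs => rw [hsplit]
  rw [← one_mul (coeff e h), ← monomial_mul, one_mul, X_pow_eq_monomial]

/-- [OURS · K3.4] FAITHFULNESS: under `TowerPermissible z g b m` the total transforms are divisible by the expected power
of the exceptional variable, `X_z^{kb} ∣ zIter z k g` for `k ≤ m + 1` — so the defining condition
`zIter z k g ∈ 𝔪^{(k+1)b}` says exactly that the controlled transform `X_z^{−kb}·zIter z k g` (Def. 2.1 with the
literal exponent `b`) has order `≥ b` at `R_k`. [folklore] -/
theorem X_pow_dvd_zIter_of_towerPermissible (z : σ) {g : MvPolynomial σ R} {b m : ℕ}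
    (hT : TowerPermissible z g b m) : ∀ k ≤ m + 1, (X z : MvPolynomial σ R) ^ (k * b) ∣ zIter z k g := by
  intro k hk
  cases k with
  | zero => simp
  | succ k =>
    rw [zIter_succ]
    exact X_pow_dvd_zChart_of_mem_pow z (hT k (by omega))

/-! ## Dictionary: the prior witness is the `σ = Fin 3`, `z = 2` instance -/

section FinThree

open Literature.AlgebraicGeometry.Hironaka2017

/-- [OURS · K3.4] In three variables with axis variable `z = X_2` the general z-chart is the prior `CuspContact.σt`
(`x ↦ xz, y ↦ yz, z ↦ z`). [folklore] -/
theorem zChart_fin_three : zChart (R := R) (2 : Fin 3) = CuspContact.σt := by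
  refine MvPolynomial.algHom_ext fun i => ?_
  by_cases h2 : i = 2
  · subst h2
    rw [zChart_X_self]
    exact (CuspContact.σt_t).symm
  · rw [zChart_X_ne _ h2]
    have hi : i = 0 ∨ i = 1 := by
      fin_cases i <;> simp at h2 ⊢
    rcases hi with rfl | rfl
    · exact (CuspContact.σt_x).symm
    · exact (CuspContact.σt_y).symm

/-- [OURS · K3.4] `zIter (2 : Fin 3)` is the prior `AxisEscape.zIter`. [folklore] -/
theorem zIter_fin_three (k : ℕ) (g : MvPolynomial (Fin 3) R) : zIter (2 : Fin 3) k g = AxisEscape.zIter k g := by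
  induction k with
  | zero => simp only [zIter_zero, AxisEscape.zIter_zero]
  | succ k ih => rw [zIter_succ, AxisEscape.zIter_succ, ih, zChart_fin_three]

/-- [OURS · K3.4] In three variables `𝔪 = idealOfVars = (x, y, z)` is the prior `CuspContact.M`. [folklore] -/
theorem idealOfVars_fin_three : idealOfVars (Fin 3) R = CuspContact.M := by
  unfold idealOfVars CuspContact.M
  congr 1
  ext f
  simp only [Set.mem_range, Set.mem_insert_iff, Set.mem_singleton_iff]
  constructor
  · rintro ⟨i, rfl⟩
    fin_cases i <;> simp
  · rintro (rfl | rfl | rfl)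
    · exact ⟨0, rfl⟩
    · exact ⟨1, rfl⟩
    · exact ⟨2, rfl⟩

/-- [OURS · K3.4] DICTIONARY: the general tower-permissibility at `σ = Fin 3`, `z = 2` IS the prior
`AxisEscape.TowerPermissible` — the prior witness is literally an instance of this file. [folklore] -/
theorem towerPermissible_fin_three_iff (g : MvPolynomial (Fin 3) R) (b m : ℕ) :
    TowerPermissible (2 : Fin 3) g b m ↔ AxisEscape.TowerPermissible g b m := by
  simp only [TowerPermissible, AxisEscape.TowerPermissible, zIter_fin_three, idealOfVars_fin_three]

/-- [OURS · K3.4] In three variables the axis weight is `i + j` (the prior `wxy`). [folklore] -/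
theorem axisWt_fin_three (e : Fin 3 →₀ ℕ) : axisWt (2 : Fin 3) e = e 0 + e 1 := by
  have h := degree_eq_add_axisWt (2 : Fin 3) e
  rw [AxisEscape.degree_fin3] at h
  omega

/-- [OURS · K3.4] The prior three-variable escape, recovered as an instance (sanity link). [folklore] -/
theorem prior_escape_as_instance {g : MvPolynomial (Fin 3) R} {b : ℕ} {e : Fin 3 →₀ ℕ} (he : e ∈ g.support)
    (hb : e 0 + e 1 < b) : ¬ AxisEscape.TowerPermissible g b (e 2) := by
  rw [← towerPermissible_fin_three_iff]
  exact not_towerPermissible_of_mem_support (2 : Fin 3) he (by rwa [axisWt_fin_three])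

end FinThree

/-! ## The maximal-contact plane: the AR-reduction of the witness keeps the axis in `Sing`, every isolated focus escapes -/

section Plane

/-- [OURS · K3.4] The restriction `x²z² − x⁵` (variables `0 = x`, `1 = z`) of the witness `y² − x²z² + x⁵` to the
maximal-contact plane `{y = 0} ≅ 𝔸²_{x,z}` — a generator of the ambient reduction `Ê♯·𝒪_Y` of Th. 3.10 up to the other
(squared-derivative) generators — lies in `(x)²`: on the plane the z-axis lies in `Sing((x²z² − x⁵, 2))` — consistent with
`Sing(Ê) =` z-axis upstairs; by `mem_axisIdeal_pow_iff` its axis tower is permissible-compatible (no escape from the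
REDUCTION OF `Ê` ITSELF — exactly as upstairs). [folklore] -/
theorem witnessOnPlane_mem :
    (X 0 ^ 2 * X 1 ^ 2 - X 0 ^ 5 : MvPolynomial (Fin 2) R) ∈ axisIdeal (R := R) (1 : Fin 2) ^ 2 := by
  have hx : (X 0 : MvPolynomial (Fin 2) R) ∈ axisIdeal (R := R) (1 : Fin 2) :=
    Ideal.subset_span ⟨0, by decide, rfl⟩
  have hx2 : (X 0 : MvPolynomial (Fin 2) R) ^ 2 ∈ axisIdeal (R := R) (1 : Fin 2) ^ 2 := Ideal.pow_mem_pow hx 2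
  have e : (X 0 ^ 2 * X 1 ^ 2 - X 0 ^ 5 : MvPolynomial (Fin 2) R) = X 0 ^ 2 * (X 1 ^ 2 - X 0 ^ 3) := by ring
  rw [e]
  exact Ideal.mul_mem_right _ _ hx2

/-- [OURS · K3.4] ON THE PLANE EVERY ISOLATED FOCUS ESCAPES: any `g ∈ R[x,z]` with a monomial `x^i z^l`, `i < b` — i.e.
any literal pair `(A, b)` on the maximal-contact plane whose singular locus does not contain the z-axis, in particular
one with `Sing = {O}` — loses the induced tower by step `l`. This is the AR-REDUCED form of the prior escape. [folklore] -/
theorem plane_escape {g : MvPolynomial (Fin 2) R} {b : ℕ} {e : Fin 2 →₀ ℕ} (he : e ∈ g.support) (hb : e 0 < b) :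
    ¬ TowerPermissible (1 : Fin 2) g b (e 1) := by
  refine not_towerPermissible_of_mem_support (1 : Fin 2) he ?_
  have h := degree_eq_add_axisWt (1 : Fin 2) e
  rw [Finsupp.degree_eq_sum, Fin.sum_univ_two] at h
  omega

end Plane

end Summit.ResolutionOfSingularities.ResolutionOfSingularities.Theorems.CampaignW34

end
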